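import Summits.Parity.GeneralizedHardyLittlewood.Theorems.LeeYangFibresCellParityLawKernelDefs
import Summits.Parity.GeneralizedHardyLittlewood.Theorems.LeeYangFibresCellParityLawPrLawTwoPrep
import Summits.Parity.GeneralizedHardyLittlewood.Theorems.LeeYangFibresCellParityLawPrLawTwoAssembly
import Summits.Parity.GeneralizedHardyLittlewood.Theorems.LeeYangFibresCellParityLawDimension
import Literature.NumberTheory.Sieve.LinearEquationsInPrimesCountSandwich
import HarnessLib

/-!
# Route `LeeYangFibres`, crux `CellParityLaw` (stmt-Parity-14109), line `section-annihilator`: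
# the registered stub `stub_geThreeHyp` — the kernel's hypotheses for the localised section sequence

Skeleton v13 (lead c2) reshapes the `u ≥ 3` rung of Bombieri's `P_r` law for the sections into the abstract
kernel `EffectiveRoughCellLaw` (an effective Bombieri law for the rough `Ω`-cells of ONE sifted sequence) and
provable glue. This file proves the glue statement `GeThreeHyp`:

  `SectionSeqBFacts → SectionSeqBCells → SectionDimension → SectionDimensionLow →
     ∀ t ≥ 1, SectionLevelAt t → KernelReadyAt t`,

i.e. that for `N ≥ N₀(t, L, u, A, B₂)` the Bombieri-normalised section sequence `𝒜 = secSeqB Ψ K N u i j'` of a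
non-degenerate system of size `≤ L`, a convex body `K ⊆ [-N,N]` localised to `ψ_i > x/Λ`, a coordinate with
no degenerate prime and frozen cells, with the parameters `x = 2LN`, `z = N^{1/u}`, `η = 2(log log N)^{-B₂}`,
`Λ = (log N)^{t+2}`, `w₀ = (log N)²`, `R = N/(log N)^A`, `A₁ = t+2`, `L' = max(L'_{dim}, L₁)`, satisfies every
hypothesis of the kernel VERBATIM: the eight range conditions (elementary asymptotics in `N`), the weight and
support conditions and the cell/size/`V(z)` identifications (`SectionSeqBCells`, `SectionSeqBFacts`, values
`≤ 2LN` by `PrLawTwoPrep`), the density bounds (`SectionDimension`, `SectionDimensionLow`), and the Type-I bound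
for EVERY truncation `y ≤ x` — the atom `SectionLevelAt t` applied to the convex body `K ∩ {ψ_i ≤ y}` at the
level `N^{1-(log log N)^{-B₂}} ≥ x^{1-η}` with saving `(log N)^{-A}`.

References: E. Bombieri, RIMS Kôkyûroku 294 (1977) p. 5 [BombieriRIMS1977]; J. Friedlander, H. Iwaniec,
Ann. Sc. Norm. Sup. Pisa (4) 5 (1978) §4 [FriedlanderIwaniecPisa1978].
-/

noncomputable section

open scoped BigOperators Topology Classical
open Finset Filter Literature.NumberTheory.Sieve

namespace Summit.Parity.GeneralizedHardyLittlewood.Cruxes.CellParityLaw.SectionAnnihilator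

namespace GeThreeHypAux

/-! ## Small tools -/

/-- Iwaniec's dimension condition is monotone in the constant `L`. -/
theorem hasIwaniecDimension_mono {g : ArithmeticFunction ℝ} {κ L L₂ : ℝ}
    (h : HasIwaniecDimension g κ L) (hle : L ≤ L₂) : HasIwaniecDimension g κ L₂ := by
  refine ⟨h.1, fun w z hw hwz => (h.2 w z hw hwz).trans ?_⟩
  have hlogw : 0 < Real.log w := Real.log_pos (by linarith)
  have hlogz : 0 ≤ Real.log z := Real.log_nonneg (by linarith)
  have h0 : 0 ≤ (Real.log z / Real.log w) ^ κ := Real.rpow_nonneg (div_nonneg hlogz hlogw.le) κ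
  gcongr

/-! ## The eight range conditions, eventually in `N` -/

/-- Eventually `(2LN)^{1/(u+1)} ≤ N^{1/u}` (i.e. `2L ≤ N^{1/u}`). -/
theorem eventually_range_z_lower (L u : ℕ) (hu : 2 ≤ u) :
    ∀ᶠ N : ℕ in atTop, (2 * (L : ℝ) * N) ^ (1 / ((u : ℝ) + 1)) ≤ (N : ℝ) ^ ((1 : ℝ) / u) := by
  have hu0 : (0 : ℝ) < u := by exact_mod_cast (by omega : 0 < u)
  have h1 : Tendsto (fun N : ℕ => (N : ℝ) ^ ((1 : ℝ) / u)) atTop atTop :=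
    (tendsto_rpow_atTop (by positivity)).comp tendsto_natCast_atTop_atTop
  filter_upwards [h1.eventually_ge_atTop (2 * (L : ℝ)), eventually_ge_atTop 1] with N hN hN1
  have hN0 : (0 : ℝ) < N := by exact_mod_cast hN1
  have hz0 : 0 < (N : ℝ) ^ ((1 : ℝ) / u) := Real.rpow_pos_of_pos hN0 _
  -- `2LN ≤ N^{1/u} · N = N^{1/u + 1}`
  have hle : 2 * (L : ℝ) * N ≤ (N : ℝ) ^ ((1 : ℝ) / u + 1) := by
    rw [Real.rpow_add hN0, Real.rpow_one]
    exact mul_le_mul_of_nonneg_right hN hN0.le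
  have hexp : 0 ≤ 1 / ((u : ℝ) + 1) := by positivity
  calc (2 * (L : ℝ) * N) ^ (1 / ((u : ℝ) + 1))
      ≤ ((N : ℝ) ^ ((1 : ℝ) / u + 1)) ^ (1 / ((u : ℝ) + 1)) :=
        Real.rpow_le_rpow (by positivity) hle hexp
    _ = (N : ℝ) ^ ((1 : ℝ) / u) := by
        rw [← Real.rpow_mul hN0.le]
        congr 1
        field_simp
        ring

/-- `N^{1/u} ≤ (2LN)^{1/u}` for `L ≥ 1`. -/
theorem range_z_upper {L : ℕ} (hL : 1 ≤ L) (N u : ℕ) :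
    (N : ℝ) ^ ((1 : ℝ) / u) ≤ (2 * (L : ℝ) * N) ^ ((1 : ℝ) / u) := by
  have hL1 : (1 : ℝ) ≤ L := by exact_mod_cast hL
  have hN0 : (0 : ℝ) ≤ N := Nat.cast_nonneg N
  refine Real.rpow_le_rpow hN0 ?_ (by positivity)
  nlinarith

/-- Eventually `(log (2LN))^{-1/2} ≤ 2/(log log N)^{B₂}`. -/
theorem eventually_range_eta_lower (L B₂ : ℕ) (hL : 1 ≤ L) :
    ∀ᶠ N : ℕ in atTop, Real.log (2 * (L : ℝ) * N) ^ (-(1 / 2 : ℝ)) ≤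
      2 / Real.log (Real.log (N : ℝ)) ^ B₂ := by
  have hL1 : (1 : ℝ) ≤ L := by exact_mod_cast hL
  filter_upwards [PrLawTwoAssemblyAux.eventually_loglog_pow_le (2 * B₂) one_pos,
    PrLawTwoAssemblyAux.eventually_le_loglog 1, eventually_ge_atTop 2] with N hN hll1 hN2
  have hN0 : (0 : ℝ) < N := by exact_mod_cast (by omega : 0 < N)
  set ℓ := Real.log (N : ℝ) with hℓ
  set ℓℓ := Real.log ℓ with hℓℓ
  have hℓℓ0 : 0 < ℓℓ := by linarith
  have hℓ0 : 0 < ℓ := by rw [hℓ]; exact Real.log_pos (by exact_mod_cast hN2)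
  rw [one_mul] at hN
  -- `(ℓℓ^{B₂})² ≤ ℓ`, so `ℓℓ^{B₂} ≤ ℓ^{1/2}`
  have hsq : (ℓℓ ^ B₂) ^ 2 ≤ ℓ := by rw [← pow_mul, mul_comm]; exact hN
  have hroot : ℓℓ ^ B₂ ≤ ℓ ^ (1 / 2 : ℝ) := by
    rw [← Real.sqrt_eq_rpow]
    exact Real.le_sqrt_of_sq_le hsq
  have hpow0 : 0 < ℓℓ ^ B₂ := pow_pos hℓℓ0 _
  -- `log (2LN) ≥ ℓ`, exponent negative
  have hlogx : ℓ ≤ Real.log (2 * (L : ℝ) * N) := by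
    rw [hℓ]; exact Real.log_le_log hN0 (by nlinarith)
  calc Real.log (2 * (L : ℝ) * N) ^ (-(1 / 2 : ℝ)) ≤ ℓ ^ (-(1 / 2 : ℝ)) :=
        Real.rpow_le_rpow_of_nonpos hℓ0 hlogx (by norm_num)
    _ = (ℓ ^ (1 / 2 : ℝ))⁻¹ := by rw [Real.rpow_neg hℓ0.le]
    _ ≤ (ℓℓ ^ B₂)⁻¹ := inv_anti₀ hpow0 hroot
    _ = 1 / ℓℓ ^ B₂ := (one_div _).symm
    _ ≤ 2 / ℓℓ ^ B₂ := by gcongr; norm_num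

/-- Eventually `2/(log log N)^{B₂} ≤ 1/(4u)` (`B₂ ≥ 1`). -/
theorem eventually_range_eta_upper (u B₂ : ℕ) (hu : 1 ≤ u) (hB₂ : 1 ≤ B₂) :
    ∀ᶠ N : ℕ in atTop, 2 / Real.log (Real.log (N : ℝ)) ^ B₂ ≤ 1 / (4 * (u : ℝ)) := by
  filter_upwards [PrLawTwoAssemblyAux.eventually_le_loglog (max 1 (8 * (u : ℝ) + 8))] with N hN
  set ℓℓ := Real.log (Real.log (N : ℝ)) with hℓℓ
  have h1 : 1 ≤ ℓℓ := le_trans (le_max_left _ _) hN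
  have h8 : 8 * (u : ℝ) + 8 ≤ ℓℓ := le_trans (le_max_right _ _) hN
  have hpow : ℓℓ ≤ ℓℓ ^ B₂ := le_self_pow₀ h1 (by omega)
  have hu1 : (1 : ℝ) ≤ u := by exact_mod_cast hu
  rw [div_le_div_iff₀ (by positivity) (by positivity)]
  nlinarith

/-- Eventually `(log N)^k ≤ (2LN)^{2/(log log N)^{B₂}}` (`L ≥ 1`). -/
theorem eventually_logpow_le_xpow_eta (L B₂ k : ℕ) (hL : 1 ≤ L) :
    ∀ᶠ N : ℕ in atTop, Real.log (N : ℝ) ^ k ≤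
      (2 * (L : ℝ) * N) ^ (2 / Real.log (Real.log (N : ℝ)) ^ B₂) := by
  have hL1 : (1 : ℝ) ≤ L := by exact_mod_cast hL
  filter_upwards [PrLawTwoAssemblyAux.eventually_const_mul_loglog_pow_le (B₂ + 1) ((k : ℝ) / 2)
      (by positivity), PrLawTwoAssemblyAux.eventually_le_loglog 1, eventually_ge_atTop 2] with N hN hll1 hN2
  have hN0 : (0 : ℝ) < N := by exact_mod_cast (by omega : 0 < N)
  set ℓ := Real.log (N : ℝ) with hℓ
  set ℓℓ := Real.log ℓ with hℓℓ
  have hℓℓ0 : 0 < ℓℓ := by linarith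
  have hℓ0 : 0 < ℓ := by rw [hℓ]; exact Real.log_pos (by exact_mod_cast hN2)
  set η : ℝ := 2 / ℓℓ ^ B₂ with hη
  have hη0 : 0 < η := by rw [hη]; positivity
  -- `k ℓℓ ≤ η ℓ`
  have hkey : (k : ℝ) * ℓℓ ≤ η * ℓ := by
    rw [hη, div_mul_eq_mul_div, le_div_iff₀ (by positivity)]
    calc (k : ℝ) * ℓℓ * ℓℓ ^ B₂ = 2 * ((k : ℝ) / 2 * ℓℓ ^ (B₂ + 1)) := by ring
      _ ≤ 2 * ℓ := by linarith
  -- `(log N)^k = exp (k ℓℓ) ≤ exp (η ℓ) = N^η ≤ (2LN)^η`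
  have h1 : ℓ ^ k = Real.exp ((k : ℝ) * ℓℓ) := by
    rw [← Real.rpow_natCast ℓ k, Real.rpow_def_of_pos hℓ0, mul_comm, hℓℓ]
  have h2 : (N : ℝ) ^ η = Real.exp (η * ℓ) := by
    rw [Real.rpow_def_of_pos hN0, hℓ, mul_comm]
  calc ℓ ^ k = Real.exp ((k : ℝ) * ℓℓ) := h1
    _ ≤ Real.exp (η * ℓ) := Real.exp_le_exp.mpr hkey
    _ = (N : ℝ) ^ η := h2.symm
    _ ≤ (2 * (L : ℝ) * N) ^ η := Real.rpow_le_rpow hN0.le (by nlinarith) hη0.le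

/-- Eventually `(2LN)^{1-1/(4u)} ≤ N/(log N)^{t+2}` (`L ≥ 1`, `u ≥ 2`). -/
theorem eventually_size_lower (L u t : ℕ) (hL : 1 ≤ L) (hu : 2 ≤ u) :
    ∀ᶠ N : ℕ in atTop, (2 * (L : ℝ) * N) ^ (1 - 1 / (4 * (u : ℝ))) ≤
      (N : ℝ) / Real.log N ^ (t + 2) := by
  have hL1 : (1 : ℝ) ≤ L := by exact_mod_cast hL
  have hu0 : (0 : ℝ) < u := by exact_mod_cast (by omega : 0 < u)
  set c : ℝ := 1 / (4 * (u : ℝ)) with hc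
  have hc0 : 0 < c := by rw [hc]; positivity
  -- `(log x)^{t+2} = o(x^c)`: eventually `(log N)^{t+2} ≤ (1/(2L)) N^c`
  have hlo := (isLittleO_log_rpow_rpow_atTop ((t : ℝ) + 2) hc0).def (show (0 : ℝ) < 1 / (2 * L) by positivity)
  have hlo' : ∀ᶠ N : ℕ in atTop, Real.log (N : ℝ) ^ (t + 2) ≤ 1 / (2 * (L : ℝ)) * (N : ℝ) ^ c := by
    filter_upwards [tendsto_natCast_atTop_atTop.eventually hlo, eventually_ge_atTop 1] with N hN hN1
    have hN0 : (0 : ℝ) < N := by exact_mod_cast hN1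
    have hlog0 : 0 ≤ Real.log (N : ℝ) := Real.log_nonneg (by exact_mod_cast hN1)
    rw [Real.norm_of_nonneg (Real.rpow_nonneg hlog0 _), Real.norm_of_nonneg (Real.rpow_nonneg hN0.le _),
      show ((t : ℝ) + 2) = ((t + 2 : ℕ) : ℝ) by push_cast; ring, Real.rpow_natCast] at hN
    exact hN
  filter_upwards [hlo', eventually_ge_atTop 2] with N hN hN2
  have hN0 : (0 : ℝ) < N := by exact_mod_cast (by omega : 0 < N)
  have hlog0 : 0 < Real.log (N : ℝ) := Real.log_pos (by exact_mod_cast (by omega : 1 < N))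
  have hlogpow : 0 < Real.log (N : ℝ) ^ (t + 2) := pow_pos hlog0 _
  have hx0 : 0 < 2 * (L : ℝ) * N := by positivity
  -- `(2LN)^{1-c} = 2LN · (2LN)^{-c} ≤ 2LN · N^{-c}`
  have h1 : (2 * (L : ℝ) * N) ^ (1 - c) ≤ 2 * (L : ℝ) * N * (N : ℝ) ^ (-c) := by
    rw [Real.rpow_sub hx0, Real.rpow_one, div_eq_mul_inv, ← Real.rpow_neg hx0.le]
    refine mul_le_mul_of_nonneg_left ?_ hx0.le
    exact Real.rpow_le_rpow_of_nonpos hN0 (by nlinarith) (by linarith)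
  -- `2L (log N)^{t+2} ≤ N^c`
  have h2 : 2 * (L : ℝ) * Real.log (N : ℝ) ^ (t + 2) ≤ (N : ℝ) ^ c := by
    have := mul_le_mul_of_nonneg_left hN (show (0 : ℝ) ≤ 2 * L by positivity)
    rwa [← mul_assoc, show 2 * (L : ℝ) * (1 / (2 * L)) = 1 by field_simp, one_mul] at this
  rw [le_div_iff₀ hlogpow]
  calc (2 * (L : ℝ) * N) ^ (1 - c) * Real.log (N : ℝ) ^ (t + 2)
      ≤ 2 * (L : ℝ) * N * (N : ℝ) ^ (-c) * Real.log (N : ℝ) ^ (t + 2) :=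
        mul_le_mul_of_nonneg_right h1 hlogpow.le
    _ = (N : ℝ) ^ (-c) * N * (2 * (L : ℝ) * Real.log (N : ℝ) ^ (t + 2)) := by ring
    _ ≤ (N : ℝ) ^ (-c) * N * (N : ℝ) ^ c :=
        mul_le_mul_of_nonneg_left h2 (by positivity)
    _ = N := by
        rw [mul_comm, ← mul_assoc, ← Real.rpow_add hN0, add_neg_cancel, Real.rpow_zero, one_mul]

/-- Eventually `⌊(2LN)^{1-2ε}⌋ ≤ ⌊N^{1-ε}⌋`, `ε = (log log N)^{-B₂}` (`L ≥ 1`): the kernel's level `x^{1-η}`,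
`η = 2ε`, is below the atom's level. -/
theorem eventually_level_le (L B₂ : ℕ) (hL : 1 ≤ L) :
    ∀ᶠ N : ℕ in atTop, ⌊(2 * (L : ℝ) * N) ^ (1 - 2 / Real.log (Real.log (N : ℝ)) ^ B₂)⌋₊ ≤
      ⌊(N : ℝ) ^ (1 - 1 / Real.log (Real.log (N : ℝ)) ^ B₂)⌋₊ := by
  have hL1 : (1 : ℝ) ≤ L := by exact_mod_cast hL
  have hlog2L : 0 ≤ Real.log (2 * (L : ℝ)) := Real.log_nonneg (by linarith)
  filter_upwards [PrLawTwoAssemblyAux.eventually_const_mul_loglog_pow_le B₂ (Real.log (2 * L)) hlog2L,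
    PrLawTwoAssemblyAux.eventually_le_loglog 2, eventually_ge_atTop 2] with N hN hll2 hN2
  have hN0 : (0 : ℝ) < N := by exact_mod_cast (by omega : 0 < N)
  set ℓ := Real.log (N : ℝ) with hℓ
  set ℓℓ := Real.log ℓ with hℓℓ
  have hℓℓ1 : 1 ≤ ℓℓ := by linarith
  have hℓ0 : 0 < ℓ := by rw [hℓ]; exact Real.log_pos (by exact_mod_cast hN2)
  set ε : ℝ := 1 / ℓℓ ^ B₂ with hε
  have hpow1 : 1 ≤ ℓℓ ^ B₂ := one_le_pow₀ hℓℓ1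
  have hε0 : 0 < ε := by rw [hε]; positivity
  have hε1 : ε ≤ 1 := by rw [hε, div_le_one (by positivity)]; exact hpow1
  have h2ε : 2 / ℓℓ ^ B₂ = 2 * ε := by rw [hε]; ring
  rw [h2ε]
  refine Nat.floor_le_floor ?_
  have hx0 : 0 < 2 * (L : ℝ) * N := by positivity
  rw [Real.rpow_def_of_pos hx0, Real.rpow_def_of_pos hN0, Real.exp_le_exp, Real.log_mul (by positivity) hN0.ne',
    ← hℓ]
  -- `(1-2ε)(log 2L + ℓ) ≤ (1-ε) ℓ` iff `(1-2ε) log 2L ≤ ε ℓ`; and `log 2L · ℓℓ^{B₂} ≤ ℓ` gives `log 2L ≤ ε ℓ`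
  have hkey : Real.log (2 * (L : ℝ)) ≤ ε * ℓ := by
    rw [hε, div_mul_eq_mul_div, le_div_iff₀ (by positivity), one_mul]
    exact hN
  nlinarith [mul_nonneg hε0.le hlog2L]

end GeThreeHypAux

open GeThreeHypAux PrLawTwoAssemblyAux in
/-- **`stub_geThreeHyp`** (registered stub of skeleton v13, line `section-annihilator`): the kernel's hypotheses
for the localised section sequence, `GeThreeHyp`. -/
theorem stub_geThreeHyp : GeThreeHyp := by
  intro hF hC hD hDl t _ht hA L u A B₂ hu hB₂
  -- the vacuous case `L = 0` (a non-degenerate system has size `≥ 1`)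
  rcases Nat.eq_zero_or_pos L with hL0 | hLpos
  · refine ⟨0, 0, fun N _ Ψ hΨ hL K _ _ i => ?_⟩
    have h1 : (1 : ℝ) ≤ (L : ℝ) := one_le_of_affLinSize_le Ψ hΨ hL i
    rw [hL0, Nat.cast_zero] at h1
    exact absurd h1 (by norm_num)
  have hL1 : 1 ≤ L := hLpos
  have hL1r : (1 : ℝ) ≤ L := by exact_mod_cast hL1
  -- constants
  obtain ⟨L', hL'⟩ := hD t
  obtain ⟨L₁, N₁, hDl'⟩ := hDl t L
  set L'' : ℝ := max L' L₁ with hL''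
  obtain ⟨NA, hAt⟩ := hA L u A B₂ hu
  obtain ⟨-, -, -, hVal, -⟩ := stub_prLawTwoPrep
  -- all thresholds at once
  obtain ⟨N₀, hN₀⟩ := Filter.eventually_atTop.1 ((eventually_range_z_lower L u hu).and
    ((eventually_range_eta_lower L B₂ hL1).and ((eventually_range_eta_upper u B₂ (by omega) hB₂).and
    ((eventually_logpow_le_xpow_eta L B₂ (t + 2) hL1).and ((eventually_logpow_le_xpow_eta L B₂ 2 hL1).and
    ((eventually_size_lower L u t hL1 hu).and ((eventually_level_le L B₂ hL1).and
    (((Real.tendsto_log_atTop.comp tendsto_natCast_atTop_atTop).eventually_ge_atTop (2 : ℝ)).and ((eventually_ge_atTop NA).and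
    ((eventually_ge_atTop N₁).and (eventually_ge_atTop 1)))))))))))
  refine ⟨L'', N₀, fun N hN Ψ hΨ hL K hK hKN i j' hj' hlt1 hKT hF0 => ?_⟩
  obtain ⟨hz1, hη1, hη2, hΛ, hw, hsz, hlev, hlog2, hNA, hNN₁, hNone⟩ := hN₀ N hN
  have hNpos : 0 < N := hNone
  have hN0 : (0 : ℝ) < N := by exact_mod_cast hNpos
  have hlog2' : (2 : ℝ) ≤ Real.log (N : ℝ) := hlog2
  have hcoeff : (Ψ i).coeff ≠ 0 := hΨ.1 i
  -- the facts about the section sequence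
  obtain ⟨hsize, -, hrem, hsizeF, hdens, hconvle, -⟩ := hF t Ψ K N u i j'
  obtain ⟨hwt, hsuppHi, hsuppLo, hcells, -, -⟩ := hC t Ψ K N u i j'
  have hvals : ∀ n ∈ latticeBox 1 N, (((Ψ i).eval n : ℤ) : ℝ) ≤ xOf L N := fun n hn =>
    hVal (t + 1) Ψ N L hNpos hL i n hn
  obtain ⟨hdensLe, hlow⟩ := hDl' N hNN₁ Ψ hΨ hL i hlt1
  simp only [xOf, zOf, etaOf, lamOf, wOf, rOf] at hKT hvals ⊢
  refine ⟨⟨hz1, range_z_upper hL1 N u, hη1, hη2, one_le_pow₀ (by linarith), hΛ, ?_, hw⟩,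
    hwt hcoeff, fun q hq => hsuppHi _ q hvals hq, fun q hq => hsuppLo _ q hKT hq, hsize, ?_, ?_,
    hasIwaniecDimension_mono (hL' Ψ i hlt1) (le_max_left _ _), ?_, ?_,
    fun m hm => hcells _ hvals m hm, hsizeF _ hvals, hdens _⟩
  · -- `2 ≤ (log N)²`
    nlinarith
  · -- size from below
    rw [hsizeF _ hvals]
    exact hsz.trans hF0
  · -- `g(p) ≤ (t+2)/p`
    intro p hp
    change sectionDensityFn Ψ i p ≤ _
    rw [sectionDensityFn_apply Ψ i hp.ne_zero]
    exact hdensLe p hp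
  · -- the Mertens product from below above `w₀`, with `L'' ≥ L₁`
    intro w z' hw0 hwz hz'x
    have hlogw : 0 < Real.log w := Real.log_pos (by nlinarith)
    have hlogz' : 0 ≤ Real.log z' := Real.log_nonneg (by nlinarith)
    have hprod : ∏ p ∈ (Nat.primesBelow ⌈z'⌉₊).filter (fun p : ℕ => w ≤ (p : ℝ)),
        (1 - (secSeqB Ψ K N u i j').density p)⁻¹ =
        ∏ p ∈ (Nat.primesBelow ⌈z'⌉₊).filter (fun p : ℕ => w ≤ (p : ℝ)), (1 - sectionDensity Ψ i p)⁻¹ := by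
      refine Finset.prod_congr rfl fun p hp => ?_
      have hp' : p.Prime := Nat.prime_of_mem_primesBelow (Finset.mem_filter.mp hp).1
      change (1 - sectionDensityFn Ψ i p)⁻¹ = _
      rw [sectionDensityFn_apply Ψ i hp'.ne_zero]
    rw [hprod]
    refine le_trans ?_ (hlow w z' hw0 hwz hz'x)
    have h0 : 0 ≤ Real.log z' / Real.log w := div_nonneg hlogz' hlogw.le
    apply mul_le_mul_of_nonneg_left _ h0
    have : L₁ / Real.log w ≤ L'' / Real.log w :=
      div_le_div_of_nonneg_right (le_max_right _ _) hlogw.le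
    linarith
  · -- Type-I for every truncation `y ≤ x`: the atom on the convex body `K ∩ {ψ_i ≤ y}`
    intro y _hy
    set Ky : Set (Fin 1 → ℝ) := K ∩ {v | (Ψ i).realEval v ≤ y} with hKy
    have hKyconv : Convex ℝ Ky := hconvle y hK
    have hKysub : Ky ⊆ realBox 1 N := Set.inter_subset_left.trans hKN
    have hAtN := hAt N hNA Ψ hΨ hL Ky hKyconv hKysub i j' hj'
    have hterm : ∀ d ∈ (Finset.Icc 1 ⌊(2 * (L : ℝ) * N) ^ (1 - 2 / Real.log (Real.log (N : ℝ)) ^ B₂)⌋₊).filter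
        Squarefree, |(secSeqB Ψ K N u i j').remainder d y| =
          |(sectionMass Ψ Ky N u i j' d : ℝ) - sectionDensity Ψ i d * (sectionMass Ψ Ky N u i j' 1 : ℝ)| := by
      intro d hd
      have hd1 : 1 ≤ d := (Finset.mem_Icc.mp (Finset.mem_filter.mp hd).1).1
      rw [hrem d y (by omega)]
    rw [Finset.sum_congr rfl hterm]
    refine le_trans (Finset.sum_le_sum_of_subset_of_nonneg ?_ fun _ _ _ => abs_nonneg _) hAtN
    intro d hd
    obtain ⟨hdI, hdsq⟩ := Finset.mem_filter.mp hd
    obtain ⟨hd1, hdle⟩ := Finset.mem_Icc.mp hdI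
    exact Finset.mem_filter.mpr ⟨Finset.mem_Icc.mpr ⟨hd1, hdle.trans hlev⟩, hdsq⟩

end Summit.Parity.GeneralizedHardyLittlewood.Cruxes.CellParityLaw.SectionAnnihilator

end
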